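import Summits.KontsevichZagierPeriods.KontsevichZagierPeriods.Theorems.SoloInformedKZPOne
import HarnessLib
import HarnessLib.Audit

/-!
# SoloInformed — the kernel conjecture on the subgroup of rational representations of dimension ≤ 1

Solo programme `solo-KontsevichZagierPeriods-informed`, session s112, file 11 — the KERNEL FORM of
file 10.  The Kontsevich–Zagier conjecture is equivalent to `ker eval = relations` on the whole group
of formal combinations; here is that statement on the subgroup generated by the rational
representations of dimension `≤ 1` (unconditionally): an INTEGER COMBINATION `Σ cᵢ [rᵢ]` of such
representations with `Σ cᵢ · value rᵢ = 0` is a relation — e.g. the three-term identity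
`∫₁² dx/x + ∫₁³ dx/x − ∫₁⁶ dx/x = 0` is realised by the moves as it stands, not only after being
rewritten as an equality of two integrals.  This is stronger in form than the pairwise statement
`SoloInformedKZPUpTo 1` (which is the case `[r] − [r']`).

Honest placement.  The pairwise dimension-`≤ 1` rational sector of the conjecture was ALREADY closed in
the tree by other seats (`kzPeriodConjecture_dim_le_one`, two files; names seen via `lean search`
only, contents unread — membrane); files 1–10 of this session are an independent kernel proof in
the terms of this seat's ladder (`SoloInformedKZPUpTo`, `soloInformed_kzp_iff_forall_kzpUpTo`) whose
engine is the span of points and segments with its kernel property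
(`soloInformed_mem_relations_of_mem_segSpan`), of which the present file is the natural output.

References: M. Kontsevich, D. Zagier, *Periods* (2001), §1.2; A. Baker, *Transcendental Number
Theory* (1975), Thm. 2.1; A. Huber, G. Wüstholz, *Transcendence and Linear Relations of 1-Periods*
(2022), Thm. 1.2 / 13.3 (the qualitative period conjecture for all 1-periods).
-/

noncomputable section

open scoped BigOperators

namespace Summit.KontsevichZagierPeriods.KontsevichZagierPeriods.Theorems

open Literature.NumberTheory.Transcendental Literature.NumberTheory.Transcendental.KZ

/-- The subgroup of formal combinations generated by the rational representations of dimension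
`≤ 1`. -/
def soloInformedRatLEOneSpan : AddSubgroup FormalRep :=
  AddSubgroup.closure {x | ∃ (n : ℕ) (r : IntegralRep n), n ≤ 1 ∧ r.IsRational ∧ x = of r}

/-- It is contained in the span of points and segments. -/
theorem soloInformed_ratLEOneSpan_le_segSpan : soloInformedRatLEOneSpan ≤ soloInformedSegSpan :=
  (AddSubgroup.closure_le _).2 fun _ ⟨_, r, hn, hr, hx⟩ =>
    hx ▸ soloInformed_of_mem_segSpan_of_isRational hn r hr

/-- **Kernel conjecture on the rational dimension-`≤ 1` subgroup** (unconditional): a formal integer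
combination of rational representations of dimension `≤ 1` is a Kontsevich–Zagier relation if and
only if its value vanishes. [Kontsevich–Zagier 2001, §1.2; Baker 1975, Thm. 2.1; this work] -/
theorem soloInformed_mem_relations_iff_of_mem_ratLEOneSpan {x : FormalRep}
    (hx : x ∈ soloInformedRatLEOneSpan) : x ∈ relations ↔ eval x = 0 :=
  ⟨fun h => relations_le_ker_eval_holds h, fun h0 =>
    soloInformed_mem_relations_of_mem_segSpan (soloInformed_ratLEOneSpan_le_segSpan hx) h0⟩

/-- The same in indexed form: if `Σᵢ cᵢ · value (rᵢ) = 0` for rational representations `rᵢ` of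
dimensions `nᵢ ≤ 1` and integers `cᵢ`, then `Σᵢ cᵢ [rᵢ]` is a relation. [this work] -/
theorem soloInformed_sum_zsmul_of_mem_relations {ι : Type*} (s : Finset ι) (n : ι → ℕ)
    (r : ∀ i, IntegralRep (n i)) (c : ι → ℤ) (hn : ∀ i ∈ s, n i ≤ 1)
    (hr : ∀ i ∈ s, (r i).IsRational) (h0 : ∑ i ∈ s, (c i : ℝ) * (r i).value = 0) :
    ∑ i ∈ s, c i • of (r i) ∈ relations := by
  have hmem : ∑ i ∈ s, c i • of (r i) ∈ soloInformedRatLEOneSpan := by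
    refine AddSubgroup.sum_mem _ fun i hi => AddSubgroup.zsmul_mem _ ?_ _
    show of (r i) ∈ AddSubgroup.closure _
    exact AddSubgroup.subset_closure ⟨n i, r i, hn i hi, hr i hi, rfl⟩
  refine (soloInformed_mem_relations_iff_of_mem_ratLEOneSpan hmem).2 ?_
  rw [map_sum]
  simpa only [map_zsmul, eval_of, zsmul_eq_mul] using h0

end Summit.KontsevichZagierPeriods.KontsevichZagierPeriods.Theorems
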